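import Literature.MathematicalPhysics.QuantumFieldTheory.Balaban1983to89.Node00.CarriersZRegPin

/-!
# NODE 00 — DEFINER B11, FILE 4: PRINT's CUBE CLASS of [Balaban1985Variational] Theorem 1 ∕ Sect. F AT NODE 00's OBJECTS (the no-holes member),
# AS SITE SETS OF THE TORUS — the `RegCubesT` OF RECORD feeding FILE 3's pin `regPinT`, and the pinned layer `ζ.pinReg ρ (cubesOfRecordZ F ν)`

Seat `pub-ymgap-node00-def-B11` (DEFINER B11; row R141 (A) of director-ym: «is `CarriersZ` the B11 pin? one-line answer of record, else a `CarriersB11`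
stage» — THE ANSWER OF RECORD IS «IS» (pub-ymgap INBOX l.12150) AND STANDS; this file, like FILES 1–3 (`Node00.CarriersZSectE`, `Node00.CarriersZRegSound`,
`Node00.CarriersZRegPin`), is a REFINEMENT of `Node00.CarriersZ`'s residual layer `ResidZ`, never a second pin of `Residual₅.Z`).
[Balaban1985Variational] = T. Bałaban, *The variational problem and background fields in renormalization group method for lattice gauge theories*,
Commun. Math. Phys. 102 (1985) 277–309 ([B11]); [Balaban1985RegularSpaces] = *Spaces of regular gauge field configurations on a lattice and gauge fixing
conditions*, Commun. Math. Phys. 99 (1985) 75–102 ([B8], [B11]'s ref. [6]).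

WHY.  FILE 3 (`Node00.CarriersZRegPin`, p478331) PINNED the regularity datum of (9)–(10) by the optimal regularity constant, over a cube class `g : RegCubesT F K`
LEFT AS THE CONSUMER's DATA — its header's residual (c): *«print's cubes «□ ⊂ B_j(Λ_j) ∪ B_{j+1}(Λ_{j+1})», size `2MLʲη`, η-distance are NOT typed as site sets at
NODE 00»*, with the degenerate values PROVED (`regularity_regPinT_of_carrier_empty`: on a cube read as `∅` the typed clause holds for every `U`; with
`sizeM ≤ 0` it is false) — whence referee dag-ref-G's READER RULE v0.38 («a (9)–(10) count line must display non-empty carriers and `sizeM > 0`, or read `g`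
from print's cubes») and dag-n07-e's successor trigger (t2) ∕ INTENT-10 (the object below, typed here in the definer lane with n07-e's consumer-facing names).
THIS FILE TYPES PRINT's CLASS: after it, `g := cubesOfRecordZ F ν` is NO LONGER DATA but print's cubes, every carrier is NON-EMPTY (`cubesOfRecordT_carrier_nonempty`)
and every size parameter is POSITIVE (`cubesOfRecordT_sizeM_pos`) — both HYPOTHESIS-FREE —, so FILE 3's `hMq` binders are DISCHARGED
(`thm1Printed_famV_pinReg_cubesOfRecord_iff`) and the (w6) vacuity channel is CLOSED (`not_carrier_empty_cubesOfRecord`).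

PRINT (pp. 278–279, verbatim).  *«To formulate them we have to introduce a class of cubes. This class was described in Sect. F [6]. Each cube □ of this class
is contained in B_j(Λ_j) ∪ B_{j+1}(Λ_{j+1}) = Ω_j∖Ω_{j+2} for some j between 0 and k, and is a union of big blocks of the Lʲη-lattice. More exactly we assume
that □ has a size 2MLʲη, where M is a multiple of R₁M₁, and that the cube □̃ of the size (2M + 4R₁M₁)Lʲη and with the same center as □, is contained in
B_j(Λ_j) ∪ B_{j+1}(Λ_{j+1}), but not in B_{j+1}(Λ_{j+1}). We consider all cubes □ satisfying the above conditions.»*  (p. 277: *«Ω_j is a union of big blocks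
of the size M₁Lʲη»*; Theorem 1 p. 279: *«for an arbitrary cube □ in the class described above, of a size 2MLʲη, M ≦ M(ε₁) … M(ε₁) = R₁M₁(a₁∕ε₁)»*.)

THE NO-HOLES READING (NODE 00's member `⟨K, k⟩`, n07-a's `varProblemT`: `Ω_0 = … = Ω_k = T`, hence `Λ_j = Ω_j∖Ω_{j+1} = ∅` for `j < k`, `Λ_k = T⁽ᵏ⁾ = 𝔅_k`,
`Ω_{k+1} = Ω_{k+2} = ∅`).  For `j ≤ k − 2`: `Ω_j∖Ω_{j+2} = T∖T = ∅` contains no cube.  For `j = k − 1`: `B_k(Λ_k)` is everything, so «□̃ … not in B_{j+1}(Λ_{j+1})»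
fails.  For `j = k`: `B_k(Λ_k) ∪ B_{k+1}(Λ_{k+1}) = T` contains every cube and `B_{k+1}(Λ_{k+1}) = ∅` contains no non-empty one.  HENCE THE CLASS OF RECORD = ALL
SCALE-`k` CUBES: unions of big blocks of `T⁽ᵏ⁾` (side `M₁` in `T⁽ᵏ⁾`-units `Lᵏη = 1`, i.e. `LᵏM₁ = side P.L M₁ k` sites of the fine torus `T_η = Site P 0`), of
side `2M`, `M = n·R₁M₁`, `n ≥ 1` (dag-n07-e reached the same reading independently, INBOX l.14961 — credited).

DECLARED READINGS (located, flagged for node00-def ∕ the referees; nothing adjudicated here).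
* D-defB11-5-1 «GENUINE CUBES»: on a torus «the cube □̃ … is contained in [T]» is read as: □̃ IS a cube of `T_η`, i.e. it does NOT WRAP — its side in fine sites,
  `(2nR₁ + 4R₁)·LᵏM₁`, is at most the period `2L^{m+K} = P.sitesPerDir 0` (`B11CubeIdx.fits`).  Consequence, DISPLAYED not hidden (`B11CubeIdx.nonempty_iff`,
  `B11CubeIdx.isEmpty_of_lt`): on a torus of fewer than `6R₁·LᵏM₁` fine sites per direction the class at scale `k` is EMPTY and (9)–(10) say nothing there.
* D-defB11-5-2 «BIG-BLOCK WINDOW»: the big blocks of `T⁽ᵏ⁾` are indexed by DEFINER ₇'s window `Node00.cubeIndices P (side P.L M₁ k)` ([III] (2.17)'s torus cube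
  family, `Node00.SmallFieldChiOfRecord` §3); a cube of the class is given by the big-block index of its lower corner and its multiplicity `n` (all positions on the
  big-block lattice, all `n ≥ 1` that fit: «We consider all cubes □ satisfying the above conditions»).
* D-n07a-4 (n07-a, kept): the distance entering the Hölder member of (9) is the η-scale `ℓ¹` torus distance `η_k · Site.tdist` (`Setup`'s DIVERGENCE F2: print's
  `|x − x′|` up to the immaterial `ℓ¹ ∕ ℓ^∞` choice); the member's window `dist ≤ 1` = pairs within `Lᵏ` fine steps.
* NUMERICS: `R₁`, `M₁` are print's two positive integers (p. 277 «R ≥ R₁», «big blocks of the size M₁Lʲη»; [B8] (1)), carried as the structure `B11CubeNumerics`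
  (positivity included: print's integers are positive); node00-def may read `M₁ :=` `Stage7Numerics.M₁` ([III] (2.13)'s big-block size) — LOCATED, not decided here.

WHAT (all definitions total; theorems kernel bookkeeping).
§1 (cover geometry, generic `P : Params`): `boxZ lo t` (the lattice box of `ℤᵈ` with lower corner `lo` and `t` points per side, `B14BoxFix.ibox` in `FitsIn`'s shape);
`B11CubeNumerics`; ★ `B11CubeIdx P k ν` (corner big-block index ∈ window, `n ≥ 1`, `fits`); `B11CubeIdx.lo ∕ sideFine ∕ collar ∕ box ∕ boxEnl` (□ and □̃ on the
cover: EVEN side `2M·Lᵏ` fine sites exactly as printed, □̃ with the same centre), `carrierT := cover P '' box`, `enlCarrierT := cover P '' boxEnl`; faces: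
`lo_mem_box`, ★ `carrierT_nonempty`, `carrierT_subset_enlCarrierT`, `sideFine_le_sitesPerDir ∕ sideEnl_le_sitesPerDir` (no self-overlap), `unitAtZero` (the `n = 1`
cube at the zero corner), ★ `nonempty_iff`, `isEmpty_of_lt`.
§2 (record): ★ `cubesOfRecordT F K k ν : RegCubesT F K` (`Q := B11CubeIdx (F.P K) k ν`, `carrier := carrierT`, `scale := k`, `sizeM q := n·R₁·M₁`,
`dist := η_k · Site.tdist`) with its `rfl` faces, `scaleLen_eta_self` (`ξ = Lᵏη_k = 1` at NODE 00), ★ `cubesOfRecordT_sizeM_pos`, ★ `cubesOfRecordT_carrier_nonempty`,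
`not_carrier_empty_cubesOfRecord`, `cubesOfRecordT_dist_nonneg`, `exists_sizeM_le` (the clause «M ≦ M(ε₁)» is met by the `n = 1` cubes whenever `M(ε₁) ≥ R₁M₁`),
the family `cubesOfRecordZ F ν : ∀ i : ZIdx, RegCubesT F i.K` + `cubesOfRecordZ_sizeM_pos`; `Reg910ClassT` = THE (9)–(10) SENTENCE OVER PRINT's CLASS in the
∃u-form (n05-e's `Reg910T` on every cube of the class with `M ≤ Mmax`, thresholds `B₃Mε₁`, `B₄Mε₁`, `β₀ = 1`) — the count currency a future line cites by one name.
§3 (at FILE 3's pin, by name): `regularity_regPinT_cubesOfRecord_one` (non-vacuity: `U = 1` satisfies the typed clause on EVERY cube of record at positive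
thresholds), `reg910_regPinT_cubesOfRecord_iff` (the third conjunct of `Thm1At` at the pin over print's class IS `Reg910ClassT` for every minimal `U`).
§4 (layer): `ResidZ.pinRegOfRecord ζ ρ ν := ζ.pinReg ρ (cubesOfRecordZ F ν)` + `rfl` faces and commutations with n07-e's `pinCrit` and FILE 1's `withSectE`,
★★ `thm1Printed_famV_pinReg_cubesOfRecord_iff` (FILE 3's `thm1Printed_famV_pinReg_iff` with `hMq` DISCHARGED: at the layer pinned on print's cubes the leaf's
`t1` ↔ «constants on the ray `B₄ = ρB₃` with (8), uniqueness in (6), and `Reg910ClassT` for every minimal `U`» — nothing left in the regularity clause but `ρ` and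
`ν = (R₁, M₁)`), ★ `reg910T_of_b11Leaf_pinRegOfRecord` (headline: the leaf ALONE gives (9)–(10) as printed on print's non-empty cubes).

WHAT NOT.  Nothing of [Balaban1985Variational] is asserted or proved (no existence of minimal configurations, no regularity, no Sect. F statement; [B8] Thm 2 not
used); FILE 3's ray parameter `ρ = B₄(β₀)∕B₃` REMAINS displayed (its residual (a)); the general (holes) class of Sect. F [B8] over a sequence `{Ω_j}` is NOT typed
(NODE 00 has no holes); «compatible partitions» numerics (`M₁ ∣ 2L^{m+K−k}` etc.) are node00-def's admissibility side conditions, not imposed; N07 is NOT discharged;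
COUNT-NEUTRAL (5∕27 · 28∕28 unmoved); one finite `T⁴` programme at fixed `ε = L^{−K}` — NOT continuum ∕ ℝ⁴ ∕ OS ∕ mass-gap ∕ Clay.  0 `sorry` ∕ `axiom` ∕ `instance` ∕
`notation`; imports FILE 3 only; filed `--kind definition --supports stmt-QuantumFields-19902` (the definition lane's lineage tag, dag-lead WORDS-111∕112).
-/

noncomputable section

open scoped Matrix.Norms.L2Operator

namespace Literature.MathematicalPhysics.QuantumFieldTheory.Balaban1983to89.Node00

open T4Continuum AveragingRT T4FiniteEpsInhabited FlowStep FlowStepRuns DagBinding T4DatumAssembly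
open B14DomainGeom B15Eq112TorusCover
open B14BoxFix (ibox)
open B14.Eq213MaximalDomains (side)
open B11Reg910Classes (Reg910T)
open B11Thm1 (Thm1At Exists8 Unique6)
open B11Thm1CarrierT (RegCarrierT varProblemT)
open LatticeNorms (scaleLen)

/-! ## §1. Cover geometry: lattice boxes, print's cube index at NODE 00, `□` and `□̃` as site sets of the torus -/

section Box

variable {d : ℕ}

/-- The lattice box of `ℤᵈ` (universal cover of `T_η`) with lower corner `lo` and `t` points per side: `{z | ∀ i, lo_i ≤ z_i ≤ lo_i + t − 1}` — r13's
`B14BoxFix.ibox` in the shape of `B14BoxFix.FitsIn`. [cite: Balaban1985Variational, p.279 («□ has a size 2MLʲη»; bookkeeping)] -/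
def boxZ (lo : Pt d) (t : ℕ) : Set (Pt d) :=
  ibox lo (fun i => lo i + (t : ℤ) - 1)

/-- Membership in a lattice box, coordinatewise. [cite: Balaban1985Variational, p.279 (bookkeeping)] -/
theorem mem_boxZ_iff (lo : Pt d) (t : ℕ) (z : Pt d) : z ∈ boxZ lo t ↔ ∀ i, lo i ≤ z i ∧ z i ≤ lo i + (t : ℤ) - 1 :=
  Iff.rfl

/-- The lower corner lies in a box with at least one point per side. [cite: Balaban1985Variational, p.279 (bookkeeping)] -/
theorem lo_mem_boxZ (lo : Pt d) {t : ℕ} (ht : 0 < t) : lo ∈ boxZ lo t := fun i =>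
  ⟨le_rfl, by
    have h1 : (1 : ℤ) ≤ (t : ℤ) := by exact_mod_cast ht
    linarith⟩

/-- A box with at least one point per side is non-empty. [cite: Balaban1985Variational, p.279 (bookkeeping)] -/
theorem boxZ_nonempty (lo : Pt d) {t : ℕ} (ht : 0 < t) : (boxZ lo t).Nonempty :=
  ⟨lo, lo_mem_boxZ lo ht⟩

/-- `□ ⊂ □̃`: a box lies in its `c`-collar (lower corner moved down by `c`, side enlarged by `2c` — «the same center»).
[cite: Balaban1985Variational, p.279 («the cube □̃ … with the same center as □»)] -/
theorem boxZ_subset_collar (lo : Pt d) (t c : ℕ) : boxZ lo t ⊆ boxZ (fun i => lo i - (c : ℤ)) (t + 2 * c) := by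
  intro z hz i
  obtain ⟨h1, h2⟩ := hz i
  have hc : (0 : ℤ) ≤ (c : ℤ) := Nat.cast_nonneg c
  refine ⟨by linarith, ?_⟩
  push_cast
  linarith

end Box

/-- **PRINT's TWO POSITIVE INTEGERS of the cube class**: `R₁` (p. 277 «R ≥ R₁», the collar `2R₁M₁` of □̃, «M is a multiple of R₁M₁») and `M₁` (the big-block
size, p. 277 «big blocks of the size M₁Lʲη»). [cite: Balaban1985Variational, p.277 («R ≥ R₁», «big blocks of the size M₁Lʲη»), p.279; Balaban1985RegularSpaces, (1) p.76] -/
structure B11CubeNumerics where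
  /-- `R₁` -/
  R₁ : ℕ
  /-- the big-block size `M₁` -/
  M₁ : ℕ
  R₁_pos : 0 < R₁
  M₁_pos : 0 < M₁

/-- Non-vacuity of the numerics type (`R₁ = M₁ = 1`). [cite: Balaban1985Variational, p.277 (bookkeeping)] -/
def B11CubeNumerics.one : B11CubeNumerics :=
  ⟨1, 1, Nat.one_pos, Nat.one_pos⟩

section Cover

variable (P : Params)

/-- The big blocks of `T⁽ᵏ⁾` have positive side `LᵏM₁` in fine sites. [cite: Balaban1985Variational, p.277 (bookkeeping)] -/
theorem side_pos (k : ℕ) (ν : B11CubeNumerics) : 0 < side P.L ν.M₁ k :=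
  Nat.mul_pos (pow_pos P.L_pos k) ν.M₁_pos

/-- The zero big-block index lies in DEFINER ₇'s window (the window is non-empty for a positive cube side).
[cite: Balaban1988Convergent, (2.17) p.257 (bookkeeping)] -/
theorem zero_mem_cubeIndices {s : ℕ} (hs : 0 < s) : (fun _ => (0 : ℤ)) ∈ cubeIndices P s := by
  have hS : 1 ≤ P.sitesPerDir 0 := Nat.pos_of_ne_zero (P.sitesPerDir_ne_zero 0)
  have hq : 0 < (P.sitesPerDir 0 + s - 1) / s := Nat.div_pos (by omega) hs
  unfold cubeIndices
  exact Fintype.mem_piFinset.2 fun _ => Finset.mem_image.2 ⟨0, Finset.mem_range.2 hq, by simp⟩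

/-- ★ **PRINT's CUBE CLASS AT NODE 00, STEP `k` — THE INDEX**: a cube □ of the class is the union of the `(2nR₁)ᵈ` big blocks of `T⁽ᵏ⁾` (side
`side P.L M₁ k = LᵏM₁` fine sites each) with big-block indices in `corner + {0, …, 2nR₁ − 1}ᵈ`: `corner` ranges over DEFINER ₇'s big-block window
(reading D-defB11-5-2), `n ≥ 1` is the multiplicity of print's `M = n·R₁M₁` («M is a multiple of R₁M₁»), and `fits` says that □̃ — side `(2nR₁ + 4R₁)·LᵏM₁`
fine sites, same centre — does not wrap around the torus of period `2L^{m+K}` (reading D-defB11-5-1 of «the cube □̃ … is contained in …»).  At NODE 00 (no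
holes) these are ALL the cubes of the class and their scale is `j = k` (module docstring). [cite: Balaban1985Variational, pp.278–279 («We consider all cubes □
satisfying the above conditions»)] -/
structure B11CubeIdx (k : ℕ) (ν : B11CubeNumerics) where
  /-- the big-block index of the lower corner of □, in the window `Node00.cubeIndices P (side P.L ν.M₁ k)` -/
  corner : Pt P.d
  corner_mem : corner ∈ cubeIndices P (side P.L ν.M₁ k)
  /-- the multiplicity `n ≥ 1` of `M = n·R₁M₁` -/
  n : ℕ
  one_le_n : 1 ≤ n
  /-- □̃ does not wrap: its side in fine sites is at most the period -/
  fits : (2 * n * ν.R₁ + 4 * ν.R₁) * side P.L ν.M₁ k ≤ P.sitesPerDir 0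

namespace B11CubeIdx

variable {P} {k : ℕ} {ν : B11CubeNumerics}

/-- The lower corner of □ on the cover, in fine sites: `LᵏM₁ · corner`. [cite: Balaban1985Variational, p.279 (bookkeeping)] -/
def lo (q : B11CubeIdx P k ν) : Pt P.d := fun i => (side P.L ν.M₁ k : ℤ) * q.corner i

/-- The side of □ in fine sites: `2M·Lᵏ = 2nR₁ · LᵏM₁`. [cite: Balaban1985Variational, p.279 («□ has a size 2MLʲη»)] -/
def sideFine (q : B11CubeIdx P k ν) : ℕ := 2 * q.n * ν.R₁ * side P.L ν.M₁ k

/-- The collar width of □̃ in fine sites: `2R₁M₁·Lᵏ`. [cite: Balaban1985Variational, p.279 («of the size (2M + 4R₁M₁)Lʲη»)] -/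
def collar (ν : B11CubeNumerics) (P : Params) (k : ℕ) : ℕ := 2 * ν.R₁ * side P.L ν.M₁ k

/-- □ on the cover: the lattice box with lower corner `lo` and `2M·Lᵏ` points per side. [cite: Balaban1985Variational, p.279] -/
def box (q : B11CubeIdx P k ν) : Set (Pt P.d) := boxZ q.lo q.sideFine

/-- □̃ on the cover: the box of side `(2M + 4R₁M₁)Lᵏ` points «with the same center as □». [cite: Balaban1985Variational, p.279] -/
def boxEnl (q : B11CubeIdx P k ν) : Set (Pt P.d) :=
  boxZ (fun i => q.lo i - (collar ν P k : ℤ)) (q.sideFine + 2 * collar ν P k)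

/-- ★ **□ AS A SET OF SITES OF THE FINE TORUS `T_η = Site P 0`** (push-forward of the cover box by `B15Eq112TorusCover.cover`).
[cite: Balaban1985Variational, p.279] -/
def carrierT (q : B11CubeIdx P k ν) : Set (Site P 0) := cover P '' q.box

/-- **□̃ AS A SET OF SITES OF THE FINE TORUS** (the neighbourhood on which the gauge `u` of (9)–(10) lives, «defined on a neighborhood of □»).
[cite: Balaban1985Variational, p.279] -/
def enlCarrierT (q : B11CubeIdx P k ν) : Set (Site P 0) := cover P '' q.boxEnl

/-- □ has a positive number of sites per side. [cite: Balaban1985Variational, p.279 (bookkeeping)] -/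
theorem sideFine_pos (q : B11CubeIdx P k ν) : 0 < q.sideFine :=
  Nat.mul_pos (Nat.mul_pos (Nat.mul_pos two_pos q.one_le_n) ν.R₁_pos) (side_pos P k ν)

/-- The side of □̃ is `sideFine + 2·collar = (2nR₁ + 4R₁)·LᵏM₁` fine sites. [cite: Balaban1985Variational, p.279 (bookkeeping)] -/
theorem sideFine_add_two_collar (q : B11CubeIdx P k ν) : q.sideFine + 2 * collar ν P k = (2 * q.n * ν.R₁ + 4 * ν.R₁) * side P.L ν.M₁ k := by
  unfold sideFine collar
  ring

/-- NO SELF-OVERLAP of □̃: its side is at most the period of the torus (`fits`). [cite: Balaban1985Variational, p.279 (reading D-defB11-5-1)] -/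
theorem sideEnl_le_sitesPerDir (q : B11CubeIdx P k ν) : q.sideFine + 2 * collar ν P k ≤ P.sitesPerDir 0 := by
  rw [sideFine_add_two_collar]
  exact q.fits

/-- NO SELF-OVERLAP of □: its side is at most the period of the torus. [cite: Balaban1985Variational, p.279 (bookkeeping)] -/
theorem sideFine_le_sitesPerDir (q : B11CubeIdx P k ν) : q.sideFine ≤ P.sitesPerDir 0 :=
  le_trans (Nat.le_add_right _ _) q.sideEnl_le_sitesPerDir

/-- The lower corner lies in □ (on the cover). [cite: Balaban1985Variational, p.279 (bookkeeping)] -/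
theorem lo_mem_box (q : B11CubeIdx P k ν) : q.lo ∈ q.box :=
  lo_mem_boxZ q.lo q.sideFine_pos

/-- `□ ⊂ □̃` on the cover. [cite: Balaban1985Variational, p.279 («with the same center as □»)] -/
theorem box_subset_boxEnl (q : B11CubeIdx P k ν) : q.box ⊆ q.boxEnl :=
  boxZ_subset_collar q.lo q.sideFine (collar ν P k)

/-- The image of the lower corner lies in □ (an explicit site of the carrier). [cite: Balaban1985Variational, p.279 (bookkeeping)] -/
theorem cover_lo_mem_carrierT (q : B11CubeIdx P k ν) : cover P q.lo ∈ q.carrierT :=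
  ⟨q.lo, q.lo_mem_box, rfl⟩

/-- ★ **EVERY CUBE OF THE CLASS IS A NON-EMPTY SET OF SITES** (READER RULE v0.38: the (w6) channel of FILE 3 is closed on print's cubes).
[cite: Balaban1985Variational, p.279] -/
theorem carrierT_nonempty (q : B11CubeIdx P k ν) : q.carrierT.Nonempty :=
  ⟨cover P q.lo, q.cover_lo_mem_carrierT⟩

/-- No cube of the class is read as the empty site set. [cite: Balaban1985Variational, p.279 (bookkeeping)] -/
theorem carrierT_ne_empty (q : B11CubeIdx P k ν) : q.carrierT ≠ ∅ :=
  q.carrierT_nonempty.ne_empty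

/-- `□ ⊂ □̃` on the torus. [cite: Balaban1985Variational, p.279 («with the same center as □»)] -/
theorem carrierT_subset_enlCarrierT (q : B11CubeIdx P k ν) : q.carrierT ⊆ q.enlCarrierT :=
  Set.image_mono q.box_subset_boxEnl

/-- A cube in the class forces the torus to hold one □̃ of multiplicity `1`: `6R₁·LᵏM₁ ≤ 2L^{m+K}`. [cite: Balaban1985Variational, p.279 (reading D-defB11-5-1; bookkeeping)] -/
theorem six_mul_le_sitesPerDir (q : B11CubeIdx P k ν) : 6 * ν.R₁ * side P.L ν.M₁ k ≤ P.sitesPerDir 0 := by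
  have h1 : 2 * 1 * ν.R₁ ≤ 2 * q.n * ν.R₁ := Nat.mul_le_mul_right ν.R₁ (Nat.mul_le_mul_left 2 q.one_le_n)
  have h2 : 6 * ν.R₁ ≤ 2 * q.n * ν.R₁ + 4 * ν.R₁ := by omega
  exact le_trans (Nat.mul_le_mul_right _ h2) q.fits

variable (P k ν) in
/-- **THE `n = 1` CUBE AT THE ZERO CORNER** (size `M = R₁M₁`), in the class as soon as the torus holds its □̃.
[cite: Balaban1985Variational, p.279 («We consider all cubes □ satisfying the above conditions»)] -/
def unitAtZero (h : 6 * ν.R₁ * side P.L ν.M₁ k ≤ P.sitesPerDir 0) : B11CubeIdx P k ν where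
  corner := fun _ => 0
  corner_mem := zero_mem_cubeIndices P (side_pos P k ν)
  n := 1
  one_le_n := le_rfl
  fits := by
    have h6 : 2 * 1 * ν.R₁ + 4 * ν.R₁ = 6 * ν.R₁ := by ring
    rw [h6]
    exact h

/-- The unit cube has multiplicity `1`. [cite: Balaban1985Variational, p.279 (bookkeeping)] -/
theorem unitAtZero_n (h : 6 * ν.R₁ * side P.L ν.M₁ k ≤ P.sitesPerDir 0) : (unitAtZero P k ν h).n = 1 := rfl

variable (P k ν) in
/-- ★ **CENSUS OF THE CLASS, DISPLAYED**: the class at scale `k` is INHABITED iff the torus holds one □̃ of multiplicity `1`, i.e. `6R₁·LᵏM₁ ≤ 2L^{m+K}`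
fine sites per direction (reading D-defB11-5-1). [cite: Balaban1985Variational, p.279 (bookkeeping)] -/
theorem nonempty_iff : Nonempty (B11CubeIdx P k ν) ↔ 6 * ν.R₁ * side P.L ν.M₁ k ≤ P.sitesPerDir 0 :=
  ⟨fun ⟨q⟩ => q.six_mul_le_sitesPerDir, fun h => ⟨unitAtZero P k ν h⟩⟩

variable (P k ν) in
/-- The degenerate value, PROVED not hidden: on a torus with fewer than `6R₁·LᵏM₁` fine sites per direction the class at scale `k` is EMPTY (and every
sentence quantified over it holds vacuously). [cite: Balaban1985Variational, p.279 (bookkeeping)] -/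
theorem isEmpty_of_lt (h : P.sitesPerDir 0 < 6 * ν.R₁ * side P.L ν.M₁ k) : IsEmpty (B11CubeIdx P k ν) :=
  ⟨fun q => absurd q.six_mul_le_sitesPerDir (not_le.2 h)⟩

end B11CubeIdx

end Cover

/-! ## §2. The cube class OF RECORD as FILE 3's `RegCubesT`, the family over the layer index, the (9)–(10) sentence over print's class -/

section Record

variable (F : T4Family)

/-- ★★ **PRINT's CUBE CLASS OF RECORD AT NODE 00's MEMBER `⟨K, k⟩`** as FILE 3's cube-class datum: cubes `Q := B11CubeIdx (F.P K) k ν` read as the site sets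
`carrierT` of the finest torus of the `K`-th approximation, ALL OF SCALE `j = k` (no holes; `ξ = Lᵏη_k = 1`), size parameter `M = n·R₁M₁`, and the η-scale `ℓ¹`
torus distance `η_k · tdist` (reading D-n07a-4). [cite: Balaban1985Variational, pp.278–279 (the class), Thm 1 (9)–(10) p.279] -/
def cubesOfRecordT (K k : ℕ) (ν : B11CubeNumerics) : RegCubesT F K where
  Q := B11CubeIdx (F.P K) k ν
  carrier := fun q => q.carrierT
  scale := fun _ => k
  sizeM := fun q => ((q.n * ν.R₁ * ν.M₁ : ℕ) : ℝ)
  dist := fun x y => (F.P K).eta k * (Site.tdist x y : ℝ)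

variable {F}

section Faces

variable {K k : ℕ} {ν : B11CubeNumerics}

/-- The cubes of record are print's index type (`rfl`). [cite: Balaban1985Variational, p.279 (bookkeeping)] -/
theorem cubesOfRecordT_Q : (cubesOfRecordT F K k ν).Q = B11CubeIdx (F.P K) k ν := rfl

/-- The carrier of a cube of record is □ as a site set (`rfl`). [cite: Balaban1985Variational, p.279 (bookkeeping)] -/
theorem cubesOfRecordT_carrier (q : B11CubeIdx (F.P K) k ν) : (cubesOfRecordT F K k ν).carrier q = q.carrierT := rfl

/-- Every cube of record has scale `k` (`rfl`; the no-holes reading). [cite: Balaban1985Variational, p.279 (bookkeeping)] -/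
theorem cubesOfRecordT_scale (q : B11CubeIdx (F.P K) k ν) : (cubesOfRecordT F K k ν).scale q = k := rfl

/-- The size parameter of a cube of record is `M = n·R₁M₁` (`rfl`). [cite: Balaban1985Variational, p.279 («M is a multiple of R₁M₁»; bookkeeping)] -/
theorem cubesOfRecordT_sizeM (q : B11CubeIdx (F.P K) k ν) : (cubesOfRecordT F K k ν).sizeM q = ((q.n * ν.R₁ * ν.M₁ : ℕ) : ℝ) := rfl

/-- The distance of record is `η_k · tdist` (`rfl`; reading D-n07a-4). [cite: Balaban1985Variational, (9) p.279 (bookkeeping)] -/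
theorem cubesOfRecordT_dist (x y : Site (F.P K) 0) : (cubesOfRecordT F K k ν).dist x y = (F.P K).eta k * (Site.tdist x y : ℝ) := rfl

variable (F K k) in
/-- **`ξ = 1` AT NODE 00**: the scale length of a scale-`k` cube at step `k` is `Lᵏ·η_k = Lᵏ·L⁻ᵏ = 1` — the thresholds of (9)–(10) on the cubes of record are
`B₃Mε₁`, `B₄Mε₁` themselves. [cite: Balaban1985Variational, (9)–(10) p.279 («(Lʲη)⁻¹» at j = k, η = L⁻ᵏ; bookkeeping)] -/
theorem scaleLen_eta_self : scaleLen (F.L : ℝ) ((F.P K).eta k) k = 1 := by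
  have hL : (F.L : ℝ) ≠ 0 := by exact_mod_cast (lt_trans zero_lt_one F.hL.2).ne'
  show (F.L : ℝ) ^ k * ((F.L : ℝ)⁻¹) ^ k = 1
  rw [← mul_pow, mul_inv_cancel₀ hL, one_pow]

/-- ★ **EVERY SIZE PARAMETER OF RECORD IS POSITIVE** — FILE 3's binder `hMq` DISCHARGED, hypothesis-free (`n ≥ 1`, `R₁, M₁ ≥ 1`).
[cite: Balaban1985Variational, p.279 («M is a multiple of R₁M₁»)] -/
theorem cubesOfRecordT_sizeM_pos (q : B11CubeIdx (F.P K) k ν) : 0 < (cubesOfRecordT F K k ν).sizeM q := by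
  show (0 : ℝ) < ((q.n * ν.R₁ * ν.M₁ : ℕ) : ℝ)
  exact_mod_cast Nat.mul_pos (Nat.mul_pos q.one_le_n ν.R₁_pos) ν.M₁_pos

/-- ★ **EVERY CARRIER OF RECORD IS NON-EMPTY** (READER RULE v0.38 met by the object, not by a displayed binder). [cite: Balaban1985Variational, p.279] -/
theorem cubesOfRecordT_carrier_nonempty (q : B11CubeIdx (F.P K) k ν) : ((cubesOfRecordT F K k ν).carrier q).Nonempty :=
  q.carrierT_nonempty

/-- **THE (w6) VACUITY CHANNEL IS CLOSED ON PRINT's CUBES**: no cube of record is read as `∅`, so FILE 3's `regularity_regPinT_of_carrier_empty` never applies to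
the class of record. [cite: Balaban1985Variational, p.279 (bookkeeping)] -/
theorem not_carrier_empty_cubesOfRecord (q : B11CubeIdx (F.P K) k ν) : (cubesOfRecordT F K k ν).carrier q ≠ ∅ :=
  q.carrierT_ne_empty

/-- The distance of record is non-negative. [cite: Balaban1985Variational, (9) p.279 (bookkeeping)] -/
theorem cubesOfRecordT_dist_nonneg (x y : Site (F.P K) 0) : 0 ≤ (cubesOfRecordT F K k ν).dist x y :=
  mul_nonneg (pow_nonneg (inv_nonneg.2 (Nat.cast_nonneg _)) k) (Nat.cast_nonneg _)

/-- **THE CLAUSE «M ≦ M(ε₁)» IS MET**: whenever the torus holds one □̃ of multiplicity `1` and the size bound is at least `R₁M₁` (print: `M(ε₁) = R₁M₁(a₁∕ε₁) ≥ R₁M₁`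
for `ε₁ ≤ a₁`), some cube of record has `M ≤ Mmax` — the regularity clause then quantifies over a non-empty range. [cite: Balaban1985Variational, Thm 1 p.279 («M ≦ M(ε₁) … M(ε₁) = R₁M₁(a₁∕ε₁)»)] -/
theorem exists_sizeM_le (h : 6 * ν.R₁ * side (F.P K).L ν.M₁ k ≤ (F.P K).sitesPerDir 0) {Mmax : ℝ} (hM : ((ν.R₁ * ν.M₁ : ℕ) : ℝ) ≤ Mmax) :
    ∃ q : B11CubeIdx (F.P K) k ν, (cubesOfRecordT F K k ν).sizeM q ≤ Mmax :=
  ⟨B11CubeIdx.unitAtZero (F.P K) k ν h, by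
    show ((1 * ν.R₁ * ν.M₁ : ℕ) : ℝ) ≤ Mmax
    rw [one_mul]
    exact hM⟩

end Faces

variable (F) in
/-- ★ **THE CUBE CLASSES OF RECORD OVER THE LAYER INDEX** `i = ⟨K, k, _⟩`: FILE 3's `g` INSTANTIATED at print's cubes. [cite: Balaban1985Variational, pp.278–279] -/
def cubesOfRecordZ (ν : B11CubeNumerics) : ∀ i : ZIdx, RegCubesT F i.K := fun i => cubesOfRecordT F i.K i.k ν

/-- Unfolding of the family (`rfl`). [cite: Balaban1985Variational, p.279 (bookkeeping)] -/
theorem cubesOfRecordZ_apply (ν : B11CubeNumerics) (i : ZIdx) : cubesOfRecordZ F ν i = cubesOfRecordT F i.K i.k ν := rfl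

/-- ★ FILE 3's layer binder `hMq : ∀ i q, 0 < (g i).sizeM q` DISCHARGED at the family of record. [cite: Balaban1985Variational, p.279 (bookkeeping)] -/
theorem cubesOfRecordZ_sizeM_pos (ν : B11CubeNumerics) : ∀ (i : ZIdx) (q : (cubesOfRecordZ F ν i).Q), 0 < (cubesOfRecordZ F ν i).sizeM q :=
  fun _ q => cubesOfRecordT_sizeM_pos q

/-- Every carrier of the family of record is non-empty. [cite: Balaban1985Variational, p.279 (bookkeeping)] -/
theorem cubesOfRecordZ_carrier_nonempty (ν : B11CubeNumerics) (i : ZIdx) (q : (cubesOfRecordZ F ν i).Q) : ((cubesOfRecordZ F ν i).carrier q).Nonempty :=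
  cubesOfRecordT_carrier_nonempty q

variable (F) (N : ℕ) [NeZero N]

/-- ★ **THE (9)–(10) SENTENCE OVER PRINT's CLASS AT NODE 00** (∃u-form, n05-e's `Reg910T`), for ONE configuration `U` at thresholds `(B₃, B₄, ε₁)` and size bound
`Mmax`: «for every cube □ of the class with `M ≤ Mmax` there is a gauge `u` of unitary type on □ with `Uᵘ = e^{iηA}` and `|A| < B₃Mε₁`, `|∇^ηA| < B₃Mε₁`,
`‖A‖_{1,β} < B₄Mε₁` (`0 ≤ β ≤ 1`), `|∂^{η*}∂^ηA|, |Δ^ηA| < B₃Mε₁`» (scale `k`, `ξ = Lᵏη_k = 1`; distance `η_k·tdist`) — the count currency of (9)–(10) at NODE 00.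
[cite: Balaban1985Variational, Thm 1 (9)–(10) p.279] -/
def Reg910ClassT (K k : ℕ) (ν : B11CubeNumerics) (B₃ B₄ ε₁ Mmax : ℝ) (U : GaugeField (F.P K) 0 (SU N)) : Prop :=
  ∀ q : B11CubeIdx (F.P K) k ν, ((q.n * ν.R₁ * ν.M₁ : ℕ) : ℝ) ≤ Mmax →
    Reg910T F N K k U q.carrierT k (fun x y => (F.P K).eta k * (Site.tdist x y : ℝ))
      (B₃ * ((q.n * ν.R₁ * ν.M₁ : ℕ) : ℝ) * ε₁) (B₄ * ((q.n * ν.R₁ * ν.M₁ : ℕ) : ℝ) * ε₁) 1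

variable {F N}

/-- `Reg910ClassT` IS FILE 3's object sentence read at the cube class of record (`Iff.rfl`). [cite: Balaban1985Variational, Thm 1 (9)–(10) p.279 (bookkeeping)] -/
theorem reg910ClassT_iff {K k : ℕ} (ν : B11CubeNumerics) (B₃ B₄ ε₁ Mmax : ℝ) (U : GaugeField (F.P K) 0 (SU N)) :
    Reg910ClassT F N K k ν B₃ B₄ ε₁ Mmax U ↔
      ∀ q : (cubesOfRecordT F K k ν).Q, (cubesOfRecordT F K k ν).sizeM q ≤ Mmax →
        Reg910T F N K k U ((cubesOfRecordT F K k ν).carrier q) ((cubesOfRecordT F K k ν).scale q) (cubesOfRecordT F K k ν).dist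
          (B₃ * (cubesOfRecordT F K k ν).sizeM q * ε₁) (B₄ * (cubesOfRecordT F K k ν).sizeM q * ε₁) 1 :=
  Iff.rfl

/-- Non-vacuity of the sentence: the trivial configuration satisfies it at positive thresholds (n05-e's `reg910T_one`). [cite: Balaban1985Variational, (9)–(10) p.279; Balaban1985RegularSpaces, p.98] -/
theorem reg910ClassT_one {K k : ℕ} (ν : B11CubeNumerics) {B₃ B₄ ε₁ : ℝ} (hB₃ : 0 < B₃) (hB₄ : 0 < B₄) (hε₁ : 0 < ε₁) (Mmax : ℝ) :
    Reg910ClassT F N K k ν B₃ B₄ ε₁ Mmax (1 : GaugeField (F.P K) 0 (SU N)) := fun q _ =>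
  B11Reg910Classes.reg910T_one K k q.carrierT k _ (mul_pos (mul_pos hB₃ (cubesOfRecordT_sizeM_pos (F := F) q)) hε₁)
    (mul_pos (mul_pos hB₄ (cubesOfRecordT_sizeM_pos (F := F) q)) hε₁) 1

end Record

/-! ## §3. At FILE 3's pin over the class of record -/

section Pin

variable {F : T4Family} {N : ℕ} [NeZero N] {K k : ℕ} {ρ : ℝ}

/-- ★ **NON-VACUITY AT OBJECTS ON PRINT's CUBES**: at the trivial configuration `U = 1` the typed clause of Theorem 1 HOLDS at the pin on EVERY cube of record as
soon as `B₃, B₄, ε₁ > 0` (FILE 3's `regularity_regPinT_one` with its two positivity binders discharged by `cubesOfRecordT_sizeM_pos`).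
[cite: Balaban1985Variational, Thm 1 (9)–(10) p.279; Balaban1985RegularSpaces, p.98] -/
theorem regularity_regPinT_cubesOfRecord_one (hρ : 0 < ρ) (ν : B11CubeNumerics) {B₃ B₄ ε₁ : ℝ} (hB₃ : 0 < B₃) (hB₄ : 0 < B₄) (hε₁ : 0 < ε₁)
    (q : B11CubeIdx (F.P K) k ν) :
    B11.Regularity (varProblemT F N K k (regPinT F N K k ρ (cubesOfRecordT F K k ν))) B₃ B₄ ε₁ (1 : GaugeField (F.P K) 0 (SU N)) q :=
  regularity_regPinT_one hρ (cubesOfRecordT F K k ν) q (mul_pos (mul_pos hB₃ (cubesOfRecordT_sizeM_pos q)) hε₁)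
    (mul_pos (mul_pos hB₄ (cubesOfRecordT_sizeM_pos q)) hε₁)

/-- ★ **THE THIRD CONJUNCT OF `Thm1At` AT THE PIN OVER PRINT's CLASS IS `Reg910ClassT`** (constants on the ray `B₄ = ρB₃`): for every minimal configuration `U` of
(5) over `𝔘_k(B₃ε₁) ∩ 𝔅_k(V)`, (9)–(10) on every cube of the class with `M ≤ M₀` — FILE 3's `reg910_regPinT_iff` with `hMq` DISCHARGED.
[cite: Balaban1985Variational, Thm 1 p.279] -/
theorem reg910_regPinT_cubesOfRecord_iff (hρ : 0 < ρ) (ν : B11CubeNumerics) {B₃ B₄ ε₁ M₀ : ℝ} (hray : B₄ = ρ * B₃) (hB₃ : 0 < B₃) (hε₁ : 0 < ε₁)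
    (V : GaugeField (F.P K) k (SU N)) :
    B11Thm1.Reg910 (varProblemT F N K k (regPinT F N K k ρ (cubesOfRecordT F K k ν))) B₃ B₄ ε₁ M₀ V ↔
      ∀ U : GaugeField (F.P K) 0 (SU N), IsBackground (avOfRecord F N K) {U | InUkClassB11 F N K k (B₃ * ε₁) U} k V U →
        Reg910ClassT F N K k ν B₃ B₄ ε₁ M₀ U :=
  reg910_regPinT_iff hρ hray hB₃ hε₁ (fun q => cubesOfRecordT_sizeM_pos q) V

/-- FILE 2's geometry slot at the pin over the class of record (by FILE 3's `RegCubesT.toRegGeomT`). [cite: Balaban1985Variational, p.279 (bookkeeping)] -/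
def regGeomTOfRecord (N : ℕ) (K k : ℕ) (ρ : ℝ) (ν : B11CubeNumerics) : RegGeomT F N K (regPinT F N K k ρ (cubesOfRecordT F K k ν)) :=
  (cubesOfRecordT F K k ν).toRegGeomT N k ρ

end Pin

/-! ## §4. The layer pinned on print's cubes -/

section Layer

variable {F : T4Family} {N : ℕ} [NeZero N]
variable {L : ℝ} {η : ZIdx → ℝ} [Fact (0 < L)] [∀ i, Fact (0 < η i)] {β : ZIdx → Type} [∀ i, Fintype (β i)]

/-- ★ **THE RESIDUAL LAYER PINNED ON PRINT's CUBES**: FILE 3's `ζ.pinReg ρ g` at `g := cubesOfRecordZ F ν` — ratio `ρ`, numerics `ν = (R₁, M₁)`; after it the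
regularity data of every member read OBJECTS only. [cite: Balaban1985Variational, Thm 1 (9)–(10) p.279] -/
def ResidZ.pinRegOfRecord (ζ : ResidZ F N) (ρ : ℝ) (ν : B11CubeNumerics) : ResidZ F N :=
  ζ.pinReg ρ (cubesOfRecordZ F ν)

omit [NeZero N] in
/-- Unfolding (`rfl`). [cite: Balaban1985Variational, p.279 (bookkeeping)] -/
theorem ResidZ.pinRegOfRecord_eq (ζ : ResidZ F N) (ρ : ℝ) (ν : B11CubeNumerics) : ζ.pinRegOfRecord ρ ν = ζ.pinReg ρ (cubesOfRecordZ F ν) := rfl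

omit [NeZero N] in
/-- The pinned layer's regularity data are FILE 3's pin over print's cubes, member by member (`rfl`). [cite: Balaban1985Variational, (9)–(10) p.279 (bookkeeping)] -/
theorem ResidZ.pinRegOfRecord_R (ζ : ResidZ F N) (ρ : ℝ) (ν : B11CubeNumerics) :
    (ζ.pinRegOfRecord ρ ν).R = fun i : ZIdx => regPinT F N i.K i.k ρ (cubesOfRecordT F i.K i.k ν) := rfl

omit [NeZero N] in
/-- `IsCrit`, `famLG`, `famAn` are untouched (`rfl`). [cite: Balaban1985Variational, Props 2–9 pp.281–309 (bookkeeping)] -/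
theorem ResidZ.pinRegOfRecord_IsCrit_famLG_famAn (ζ : ResidZ F N) (ρ : ℝ) (ν : B11CubeNumerics) :
    (ζ.pinRegOfRecord ρ ν).IsCrit = ζ.IsCrit ∧ (ζ.pinRegOfRecord ρ ν).famLG = ζ.famLG ∧ (ζ.pinRegOfRecord ρ ν).famAn = ζ.famAn :=
  ⟨rfl, rfl, rfl⟩

/-- The pinned layer's Theorem-1 family is n07-a's carrier at the pin over print's cubes (`rfl`). [cite: Balaban1985Variational, Thm 1 p.279 (bookkeeping)] -/
theorem ResidZ.famVOfRecord_pinRegOfRecord (ζ : ResidZ F N) (ρ : ℝ) (ν : B11CubeNumerics) (i : ZIdx) :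
    famVOfRecord F N (ζ.pinRegOfRecord ρ ν) i = varProblemT F N i.K i.k (regPinT F N i.K i.k ρ (cubesOfRecordT F i.K i.k ν)) := rfl

/-- **COMMUTES WITH n07-e's CRITICALITY PIN** (`rfl`). [cite: Balaban1985Variational, Props 7–8 pp.299–300 (bookkeeping)] -/
theorem ResidZ.pinRegOfRecord_pinCrit (ζ : ResidZ F N) (ρ : ℝ) (ν : B11CubeNumerics) :
    (ζ.pinRegOfRecord ρ ν).pinCrit = ζ.pinCrit.pinRegOfRecord ρ ν := rfl

omit [NeZero N] in
/-- **COMMUTES WITH FILE 1's SECT. E PRESENTATION** (`rfl`). [cite: Balaban1985Variational, Sect. E pp.293–296 (bookkeeping)] -/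
theorem ResidZ.pinRegOfRecord_withSectE (ζ : ResidZ F N) (E : SectEPres F N L η β ζ) (ρ : ℝ) (ν : B11CubeNumerics) :
    (ζ.withSectE E).pinRegOfRecord ρ ν = (ζ.pinRegOfRecord ρ ν).withSectE (E.pinReg ρ (cubesOfRecordZ F ν)) := rfl

/-- ★★ **HEADLINE — AT THE LAYER PINNED ON PRINT's CUBES THE LEAF ALONE GIVES (9)–(10) AS PRINTED ON NON-EMPTY CUBES**: for every member `i = ⟨K, k, _⟩`, every
`0 < ε₁ ≤ a₁`, every `V` with (7) and every minimal configuration `U` of (5) over `𝔘_k(B₃ε₁) ∩ 𝔅_k(V)`: `Reg910ClassT` — on every cube □ of print's class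
(a non-empty union of big blocks of `T⁽ᵏ⁾`, `carrierT_nonempty`) with `M ≤ M(ε₁)` there is a gauge `u` with `Uᵘ = e^{iηA}` obeying (9)–(10) at `B₃Mε₁`, `B₄Mε₁`
(FILE 3's `reg910T_of_b11Leaf_pinReg` at `g := cubesOfRecordZ F ν`). [cite: Balaban1985Variational, Thm 1 pp.278–279, (9)–(10)] -/
theorem reg910T_of_b11Leaf_pinRegOfRecord {ζ : ResidZ F N} {ρ : ℝ} (hρ : 0 < ρ) {ν : B11CubeNumerics}
    (h : B11Leaf (Z11OfRecord F N (ζ.pinRegOfRecord ρ ν))) :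
    ∃ C : B11Thm1.Consts, ∀ (i : ZIdx) (ε₁ : ℝ), 0 < ε₁ → ε₁ ≤ C.a₁ → ∀ V : GaugeField (F.P i.K) i.k (SU N), PlaqSmall ε₁ V →
      ∀ U : GaugeField (F.P i.K) 0 (SU N), IsBackground (avOfRecord F N i.K) {U | InUkClassB11 F N i.K i.k (C.B₃ * ε₁) U} i.k V U →
        Reg910ClassT F N i.K i.k ν C.B₃ C.B₄ ε₁ (C.Mfun ε₁) U := by
  obtain ⟨C, hC⟩ := reg910T_of_b11Leaf_pinReg (g := cubesOfRecordZ F ν) hρ h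
  exact ⟨C, fun i ε₁ h₁ h₂ V hV U hU q hq => hC i ε₁ h₁ h₂ V hV U hU q hq⟩

/-- ★★★ **AT THE LAYER PINNED ON PRINT's CUBES, `t1` READS OBJECTS — NO BINDER LEFT**: FILE 3's `thm1Printed_famV_pinReg_iff` with `hMq` DISCHARGED by
`cubesOfRecordZ_sizeM_pos`: the leaf's Theorem-1 conjunct at the pinned layer's family ↔ «there are constants `C` on the ray `C.B₄ = ρ·C.B₃` such that every
member satisfies, for every `0 < ε₁ ≤ a₁` and `V` with (7): (8), uniqueness in (6), and `Reg910ClassT` — (9)–(10) as printed on every cube of print's class with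
`M ≤ M(ε₁)` — for every minimal `U`».  What remains displayed: the ray parameter `ρ` (FILE 3's residual (a)) and the numerics `ν = (R₁, M₁)`.
[cite: Balaban1985Variational, Thm 1 pp.278–279] -/
theorem thm1Printed_famV_pinReg_cubesOfRecord_iff {ζ : ResidZ F N} {ρ : ℝ} (hρ : 0 < ρ) (ν : B11CubeNumerics) :
    B11.Thm1Printed (famVOfRecord F N (ζ.pinReg ρ (cubesOfRecordZ F ν))) ↔
      ∃ C : B11Thm1.Consts, C.B₄ = ρ * C.B₃ ∧ ∀ (i : ZIdx) (ε₁ : ℝ), 0 < ε₁ → ε₁ ≤ C.a₁ →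
        ∀ V : GaugeField (F.P i.K) i.k (SU N), PlaqSmall ε₁ V →
          Exists8 (varProblemT F N i.K i.k (regPinT F N i.K i.k ρ (cubesOfRecordT F i.K i.k ν))) C.B₃ ε₁ V ∧
          Unique6 (varProblemT F N i.K i.k (regPinT F N i.K i.k ρ (cubesOfRecordT F i.K i.k ν))) C.a₀ C.B₃ ε₁ V ∧
          ∀ U : GaugeField (F.P i.K) 0 (SU N), IsBackground (avOfRecord F N i.K) {U | InUkClassB11 F N i.K i.k (C.B₃ * ε₁) U} i.k V U →
            Reg910ClassT F N i.K i.k ν C.B₃ C.B₄ ε₁ (C.Mfun ε₁) U :=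
  thm1Printed_famV_pinReg_iff hρ (cubesOfRecordZ_sizeM_pos ν)

/-- The same at the named layer `ζ.pinRegOfRecord ρ ν` (`rfl`-transport). [cite: Balaban1985Variational, Thm 1 pp.278–279 (bookkeeping)] -/
theorem thm1Printed_famV_pinRegOfRecord_iff {ζ : ResidZ F N} {ρ : ℝ} (hρ : 0 < ρ) (ν : B11CubeNumerics) :
    B11.Thm1Printed (famVOfRecord F N (ζ.pinRegOfRecord ρ ν)) ↔
      ∃ C : B11Thm1.Consts, C.B₄ = ρ * C.B₃ ∧ ∀ (i : ZIdx) (ε₁ : ℝ), 0 < ε₁ → ε₁ ≤ C.a₁ →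
        ∀ V : GaugeField (F.P i.K) i.k (SU N), PlaqSmall ε₁ V →
          Exists8 (varProblemT F N i.K i.k (regPinT F N i.K i.k ρ (cubesOfRecordT F i.K i.k ν))) C.B₃ ε₁ V ∧
          Unique6 (varProblemT F N i.K i.k (regPinT F N i.K i.k ρ (cubesOfRecordT F i.K i.k ν))) C.a₀ C.B₃ ε₁ V ∧
          ∀ U : GaugeField (F.P i.K) 0 (SU N), IsBackground (avOfRecord F N i.K) {U | InUkClassB11 F N i.K i.k (C.B₃ * ε₁) U} i.k V U →
            Reg910ClassT F N i.K i.k ν C.B₃ C.B₄ ε₁ (C.Mfun ε₁) U :=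
  thm1Printed_famV_pinReg_cubesOfRecord_iff hρ ν

/-- The headline at the TRIPLY-PINNED layer `((ζ.withSectE E).pinCrit).pinRegOfRecord ρ ν` a N07 closer may read (FILE 3's knit at `g := cubesOfRecordZ F ν`).
[cite: Balaban1985Variational, Thm 1 pp.278–279, (9)–(10) (bookkeeping)] -/
theorem reg910T_of_b11Leaf_withSectE_pinCrit_pinRegOfRecord {ζ : ResidZ F N} {ρ : ℝ} (hρ : 0 < ρ) {ν : B11CubeNumerics}
    (E : SectEPres F N L η β ζ) (h : B11Leaf (Z11OfRecord F N (((ζ.withSectE E).pinCrit).pinRegOfRecord ρ ν))) :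
    ∃ C : B11Thm1.Consts, ∀ (i : ZIdx) (ε₁ : ℝ), 0 < ε₁ → ε₁ ≤ C.a₁ → ∀ V : GaugeField (F.P i.K) i.k (SU N), PlaqSmall ε₁ V →
      ∀ U : GaugeField (F.P i.K) 0 (SU N), IsBackground (avOfRecord F N i.K) {U | InUkClassB11 F N i.K i.k (C.B₃ * ε₁) U} i.k V U →
        Reg910ClassT F N i.K i.k ν C.B₃ C.B₄ ε₁ (C.Mfun ε₁) U :=
  reg910T_of_b11Leaf_pinRegOfRecord (ζ := (ζ.withSectE E).pinCrit) hρ h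

end Layer

end Literature.MathematicalPhysics.QuantumFieldTheory.Balaban1983to89.Node00
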